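import Literature.NumberTheory.Automorphic.SpreadLevelGroup
import Literature.NumberTheory.Automorphic.TwistedSubgroupAverage
import Literature.NumberTheory.Automorphic.OpenSubgroupCosetIntegral
import Literature.NumberTheory.Automorphic.AutomorphicGLnWhittakerFunctionals
import Literature.NumberTheory.Automorphic.CuspidalEigenTestVector
import Literature.NumberTheory.Automorphic.RankinSelbergTorusIntegral
import Literature.NumberTheory.Automorphic.JacquetLanglandsParts
import Literature.NumberTheory.Automorphic.GlobalAdditiveCharacterProofs
import HarnessLib

/-!
# The spread projector at a finite place

Topic `NumberTheory/Automorphic`; namespace `Literature.NumberTheory.Automorphic`. The twisted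
average `E_v = ∫_{H_v} χ̄_v(h) Π(ι_v(h)) dh` over the spread level group `H_v = d H⁰ d⁻¹ ≤ GL_n(K_v)`
(`WhittakerSupport.spreadLevelGroup`) against its character `χ_v(h) = ψ_v(Σ h_{i,i+1})`, acting on a
closed subrepresentation `Π ≤ L²(GL_n(K) A_G \ GL_n(𝔸_K))`: the operator producing, in the proof of
the named fact `JacquetShalika1981_partialPairL_pole_of_eq_conj` in every rank, a vector whose
Whittaker function is spread bi-equivariant at `v` (`IsSpreadWhittakerAt`). This file: the twist
datum, `(H_v, χ_v)`-isotypy of `E_v x`, linearity, commutation with the elements of `GL_n(𝔸_K)` of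
trivial `v`-component, and the level of `E_v x` at `v`.

## References

* H. Jacquet, I. I. Piatetski-Shapiro, J. Shalika, *Conducteur des représentations du groupe
  linéaire*, Math. Ann. 256 (1981), §5.
* D. Bump, *Automorphic Forms and Representations* (1997), §4.4 [Bump1997].
-/

noncomputable section

open MeasureTheory Measure NumberField NumberField.mixedEmbedding IsDedekindDomain Matrix WithZero
open scoped MatrixGroups ComplexConjugate
open Literature.NumberTheory.Automorphic.WhittakerSupport

namespace Literature.NumberTheory.Automorphic

/-! ### The character `χ_v` -/

section Char

variable {n : ℕ} {K : Type} [Field K] [NumberField K] (v : HeightOneSpectrum (𝓞 K))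

/-- **The spread character** `χ_v(h) = ψ_v(Σ_i h_{i,i+1})` on `GL_n(K_v)`: the tree's `congChar`
(`CongruenceTwistedAverage`) at the local component `ψ_v` of Tate's character (a reducible
abbreviation, kept for the readability of the many statements below). [folklore] -/
abbrev spreadChar (h : GL (Fin n) (v.adicCompletion K)) : ℂ :=
  congChar ((adeleAddChar K).adicComponent v) h

/-- Unfolding of `spreadChar`. [folklore] -/
theorem spreadChar_apply (h : GL (Fin n) (v.adicCompletion K)) :
    spreadChar v h = ((((adeleAddChar K).adicComponent v)
      (sdiagMat (h : Matrix (Fin n) (Fin n) (v.adicCompletion K))) : Circle) : ℂ) := rfl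

/-- `|χ_v| = 1`. [folklore] -/
theorem norm_spreadChar (h : GL (Fin n) (v.adicCompletion K)) : ‖spreadChar v h‖ = 1 :=
  norm_congChar _ _

omit [NumberField K] in
/-- The super-diagonal sum is continuous on `GL_n`. [folklore] -/
theorem continuous_sdiagMat_coe {F : Type*} [Field F] [TopologicalSpace F] [IsTopologicalRing F] :
    Continuous fun h : GL (Fin n) F => sdiagMat (h : Matrix (Fin n) (Fin n) F) := by
  unfold sdiagMat
  refine continuous_finsetSum _ fun i _ => continuous_finsetSum _ fun j _ => ?_
  split_ifs
  · exact Units.continuous_val.matrix_elem i j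
  · exact continuous_const

/-- `χ_v` is continuous. [folklore] -/
theorem continuous_spreadChar : Continuous (spreadChar (n := n) v) := by
  refine continuous_subtype_val.comp ?_
  have hψ : Continuous ((adeleAddChar K).adicComponent v) := by
    have h : Continuous fun x : v.adicCompletion K => adeleAddChar K (adeleSingleHom K v x) :=
      (continuous_adeleAddChar (K := K)).comp (continuous_adeleSingleHom K v)
    exact h
  exact hψ.comp continuous_sdiagMat_coe

/-- **`χ_v` is multiplicative on `H_v`** when `ψ_v(t_i t_{i+1}⁻¹ 𝔭^M) = 1`. [folklore] -/
theorem spreadChar_mul {t : Fin n → (v.adicCompletion K)ˣ} {M : ℤ}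
    (hψ : ∀ i j : Fin n, (i : ℕ) + 1 = j → ∀ x : v.adicCompletion K, Valued.v x ≤ exp (-M) →
      (adeleAddChar K).adicComponent v ((t i : v.adicCompletion K) * (t j : v.adicCompletion K)⁻¹ * x) = 1)
    {h₁ h₂ : GL (Fin n) (v.adicCompletion K)} (hh₁ : h₁ ∈ spreadLevelGroup t M)
    (hh₂ : h₂ ∈ spreadLevelGroup t M) :
    spreadChar v (h₁ * h₂) = spreadChar v h₁ * spreadChar v h₂ := by
  rw [spreadChar_apply, spreadChar_apply, spreadChar_apply, ← Circle.coe_mul,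
    addChar_sdiagMat_mul_of_mem_spreadLevelGroup _ hψ hh₁ hh₂]

/-- **`χ_v = ψ_{v,N}` on unipotents.** [folklore] -/
theorem spreadChar_unipotent (u : ↥(upperUnitriangular (Fin n) (v.adicCompletion K))) :
    spreadChar v (u : GL (Fin n) (v.adicCompletion K)) =
      whittakerCharFun ((adeleAddChar K).adicComponent v) u := rfl

end Char

/-! ### The spread level group at `v` is compact open -/

section Compact

variable {n : ℕ} {K : Type} [Field K] [NumberField K] (v : HeightOneSpectrum (𝓞 K))

/-- `H⁰` is open in `GL_n(K_v)` (it contains `K(𝔭^M)`). [folklore] -/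
theorem isOpen_upperModLevel (M : ℤ) :
    IsOpen ((upperModLevel (F := v.adicCompletion K) n M : Subgroup (GL (Fin n) (v.adicCompletion K))) :
      Set (GL (Fin n) (v.adicCompletion K))) :=
  Subgroup.isOpen_mono valuedCongruenceSubgroup_le_upperModLevel
    (isOpen_valuedCongruenceSubgroup n K v coe_ne_zero)

/-- `H⁰` is compact (closed in `GL_n(𝒪_v)`). [folklore] -/
theorem isCompact_upperModLevel (M : ℤ) :
    IsCompact ((upperModLevel (F := v.adicCompletion K) n M : Subgroup (GL (Fin n) (v.adicCompletion K))) :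
      Set (GL (Fin n) (v.adicCompletion K))) :=
  (isCompact_valuedCongruenceSubgroup n K v one_ne_zero le_rfl).of_isClosed_subset
    (Subgroup.isClosed_of_isOpen _ (isOpen_upperModLevel v M)) upperModLevel_le_valuedCongruenceSubgroup_one

/-- The carrier of `H_v` is the conjugate of that of `H⁰`. [folklore] -/
theorem coe_spreadLevelGroup (t : Fin n → (v.adicCompletion K)ˣ) (M : ℤ) :
    ((spreadLevelGroup t M : Subgroup (GL (Fin n) (v.adicCompletion K))) : Set (GL (Fin n) (v.adicCompletion K))) =
      (fun g => glDiagonal n (v.adicCompletion K) t * g * (glDiagonal n (v.adicCompletion K) t)⁻¹) ''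
        ((upperModLevel (F := v.adicCompletion K) n M : Subgroup (GL (Fin n) (v.adicCompletion K))) :
          Set (GL (Fin n) (v.adicCompletion K))) := by
  rw [spreadLevelGroup, Subgroup.coe_map]
  rfl

/-- **`H_v` is compact.** [folklore] -/
theorem isCompact_spreadLevelGroup (t : Fin n → (v.adicCompletion K)ˣ) (M : ℤ) :
    IsCompact ((spreadLevelGroup t M : Subgroup (GL (Fin n) (v.adicCompletion K))) :
      Set (GL (Fin n) (v.adicCompletion K))) := by
  rw [coe_spreadLevelGroup]
  exact (isCompact_upperModLevel v M).image ((continuous_const.mul continuous_id).mul continuous_const)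

/-- **`H_v` is open.** [folklore] -/
theorem isOpen_spreadLevelGroup (t : Fin n → (v.adicCompletion K)ˣ) (M : ℤ) :
    IsOpen ((spreadLevelGroup t M : Subgroup (GL (Fin n) (v.adicCompletion K))) :
      Set (GL (Fin n) (v.adicCompletion K))) := by
  rw [coe_spreadLevelGroup]
  set d := glDiagonal n (v.adicCompletion K) t
  have h : (fun g : GL (Fin n) (v.adicCompletion K) => d * g * d⁻¹) =
      ((Homeomorph.mulLeft d).trans (Homeomorph.mulRight d⁻¹)) := by
    funext g
    rfl
  rw [h]
  exact (Homeomorph.isOpenMap _) _ (isOpen_upperModLevel v M)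

end Compact

/-! ### The twist datum and the projector -/

section Projector

variable {n : ℕ} {K : Type} [Field K] [NumberField K] (v : HeightOneSpectrum (𝓞 K))
variable {μ : Measure (AdelicGroupData.gl n K).automorphicQuotient} [(AdelicGroupData.gl n K).IsAutomorphicMeasure μ]

/-- `Π(a b) x = Π(a) (Π(b) x)` on a closed subrepresentation, products taken in `GL_n(𝔸_K)` so that
it rewrites (a local copy of `toContRep_mul_apply_gl` of `SatakeParameterGenericBoundFlathProofs`,
whose import — outside this file's closure — is avoided for a `map_mul` one-liner; used by the
`Spread*` files downstream). [folklore] -/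
theorem ClosedSubrep.toContRep_mul_apply (W : ContRepresentation.ClosedSubrep ((AdelicGroupData.gl n K).rightRegular μ))
    (a b : GL (Fin n) (AdeleRing (𝓞 K) K)) (x : W.toSubmodule) :
    W.toContRep (a * b) x = W.toContRep a (W.toContRep b x) :=
  (DFunLike.congr_fun (map_mul W.toContRep a b) x).trans rfl

/-- `g ↦ Π(g) x` is continuous. [folklore] -/
theorem ClosedSubrep.continuous_toContRep_apply (W : ContRepresentation.ClosedSubrep ((AdelicGroupData.gl n K).rightRegular μ))
    (x : W.toSubmodule) : Continuous fun g : GL (Fin n) (AdeleRing (𝓞 K) K) => W.toContRep g x := by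
  refine continuous_induced_rng.2 ?_
  have h : (Subtype.val ∘ fun g : GL (Fin n) (AdeleRing (𝓞 K) K) => W.toContRep g x) =
      fun g => (AdelicGroupData.gl n K).rightRegular μ g (x : (AdelicGroupData.gl n K).L2 μ) := by
    funext g
    exact ContRepresentation.ClosedSubrep.coe_toContRep_apply W g x
  rw [h]
  exact (AdelicGroupData.isStronglyContinuous_rightRegular_holds (AdelicGroupData.gl n K) μ) _

/-- **The representation of `GL_n(K_v)` on `Π` through `ι_v`.** [folklore] -/
def localRep (W : ContRepresentation.ClosedSubrep ((AdelicGroupData.gl n K).rightRegular μ)) :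
    GL (Fin n) (v.adicCompletion K) →* (W.toSubmodule →L[ℂ] W.toSubmodule) :=
  W.toContRep.toMonoidHom.comp (GLn.toAdelic n K v)

/-- Unfolding of `localRep`. [folklore] -/
theorem localRep_apply (W : ContRepresentation.ClosedSubrep ((AdelicGroupData.gl n K).rightRegular μ))
    (g : GL (Fin n) (v.adicCompletion K)) (x : W.toSubmodule) :
    localRep v W g x = W.toContRep (GLn.ofLocal n K v g) x := rfl

variable [MeasurableSpace (GL (Fin n) (v.adicCompletion K))] [BorelSpace (GL (Fin n) (v.adicCompletion K))]

omit [MeasurableSpace (GL (Fin n) (v.adicCompletion K))] [BorelSpace (GL (Fin n) (v.adicCompletion K))] in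
/-- **The spread twist datum** `(H_v, Π ∘ ι_v, χ_v)`. [cite: Bump1997, §4.4] -/
theorem isTwistData_spread (W : ContRepresentation.ClosedSubrep ((AdelicGroupData.gl n K).rightRegular μ))
    {t : Fin n → (v.adicCompletion K)ˣ} {M : ℤ}
    (hψ : ∀ i j : Fin n, (i : ℕ) + 1 = j → ∀ x : v.adicCompletion K, Valued.v x ≤ exp (-M) →
      (adeleAddChar K).adicComponent v ((t i : v.adicCompletion K) * (t j : v.adicCompletion K)⁻¹ * x) = 1) :
    IsTwistData (spreadLevelGroup t M) (localRep v W) (spreadChar v) where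
  norm_rep g x := by rw [localRep_apply]; exact norm_toContRep_apply W _ x
  continuous_rep x := (ClosedSubrep.continuous_toContRep_apply W x).comp (GLn.continuous_toAdelic n K v)
  mul_char := fun _ hj _ hj' => spreadChar_mul v hψ hj hj'
  norm_char g _ := norm_spreadChar v g
  continuous_char := (continuous_spreadChar v).comp continuous_subtype_val

/-- **The spread projector** `E_v x = ∫_{H_v} χ̄_v(h) Π(ι_v(h)) x dh`. [cite: Bump1997, §4.4] -/
def spreadProjector (W : ContRepresentation.ClosedSubrep ((AdelicGroupData.gl n K).rightRegular μ))
    (t : Fin n → (v.adicCompletion K)ˣ) (M : ℤ) (x : W.toSubmodule) : W.toSubmodule :=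
  twistedAverage (spreadLevelGroup t M) (isCompact_spreadLevelGroup v t M) (localRep v W) (spreadChar v) x

variable {v}
variable {W : ContRepresentation.ClosedSubrep ((AdelicGroupData.gl n K).rightRegular μ)}
  {t : Fin n → (v.adicCompletion K)ˣ} {M : ℤ}

/-- Unfolding of `spreadProjector`. [folklore] -/
theorem spreadProjector_def (x : W.toSubmodule) :
    spreadProjector v W t M x = ∫ j : ↥(spreadLevelGroup t M),
      (conj (spreadChar v (j : GL (Fin n) (v.adicCompletion K)))) •
        W.toContRep (GLn.ofLocal n K v (j : GL (Fin n) (v.adicCompletion K))) x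
      ∂(subgroupHaar (spreadLevelGroup t M) (isCompact_spreadLevelGroup v t M)) := rfl

/-- The integrand of `E_v` is integrable. [folklore] -/
theorem integrable_spreadProjector_integrand
    (hψ : ∀ i j : Fin n, (i : ℕ) + 1 = j → ∀ x : v.adicCompletion K, Valued.v x ≤ exp (-M) →
      (adeleAddChar K).adicComponent v ((t i : v.adicCompletion K) * (t j : v.adicCompletion K)⁻¹ * x) = 1)
    (x : W.toSubmodule) :
    Integrable (fun j : ↥(spreadLevelGroup t M) =>
      (conj (spreadChar v (j : GL (Fin n) (v.adicCompletion K)))) •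
        W.toContRep (GLn.ofLocal n K v (j : GL (Fin n) (v.adicCompletion K))) x)
      (subgroupHaar (spreadLevelGroup t M) (isCompact_spreadLevelGroup v t M)) :=
  (isTwistData_spread v W hψ).integrable_integrand x

/-- **Isotypy**: `Π(ι_v(h)) (E_v x) = χ_v(h) E_v x` for `h ∈ H_v`. [cite: Bump1997, §4.4] -/
theorem toContRep_ofLocal_spreadProjector
    (hψ : ∀ i j : Fin n, (i : ℕ) + 1 = j → ∀ x : v.adicCompletion K, Valued.v x ≤ exp (-M) →
      (adeleAddChar K).adicComponent v ((t i : v.adicCompletion K) * (t j : v.adicCompletion K)⁻¹ * x) = 1)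
    {h : GL (Fin n) (v.adicCompletion K)} (hh : h ∈ spreadLevelGroup t M) (x : W.toSubmodule) :
    W.toContRep (GLn.ofLocal n K v h) (spreadProjector v W t M x) = spreadChar v h • spreadProjector v W t M x :=
  (isTwistData_spread v W hψ).rep_twistedAverage hh x

/-- `‖E_v x‖ ≤ ‖x‖`. [folklore] -/
theorem norm_spreadProjector_le
    (hψ : ∀ i j : Fin n, (i : ℕ) + 1 = j → ∀ x : v.adicCompletion K, Valued.v x ≤ exp (-M) →
      (adeleAddChar K).adicComponent v ((t i : v.adicCompletion K) * (t j : v.adicCompletion K)⁻¹ * x) = 1)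
    (x : W.toSubmodule) : ‖spreadProjector v W t M x‖ ≤ ‖x‖ :=
  (isTwistData_spread v W hψ).norm_twistedAverage_le x

/-- `E_v` is additive. [folklore] -/
theorem spreadProjector_add
    (hψ : ∀ i j : Fin n, (i : ℕ) + 1 = j → ∀ x : v.adicCompletion K, Valued.v x ≤ exp (-M) →
      (adeleAddChar K).adicComponent v ((t i : v.adicCompletion K) * (t j : v.adicCompletion K)⁻¹ * x) = 1)
    (x y : W.toSubmodule) :
    spreadProjector v W t M (x + y) = spreadProjector v W t M x + spreadProjector v W t M y := by
  rw [spreadProjector_def, spreadProjector_def, spreadProjector_def,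
    ← integral_add (integrable_spreadProjector_integrand hψ x) (integrable_spreadProjector_integrand hψ y)]
  refine integral_congr_ae (Filter.Eventually.of_forall fun j => ?_)
  simp only [map_add, smul_add]

/-- `E_v` is homogeneous. [folklore] -/
theorem spreadProjector_smul (c : ℂ) (x : W.toSubmodule) :
    spreadProjector v W t M (c • x) = c • spreadProjector v W t M x := by
  rw [spreadProjector_def, spreadProjector_def, ← integral_smul]
  refine integral_congr_ae (Filter.Eventually.of_forall fun j => ?_)
  simp only [map_smul, smul_comm c]

/-- **`E_v` commutes with the elements of trivial `v`-component**: `Π(g) E_v x = E_v (Π(g) x)` for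
`g_v = 1`. [folklore] -/
theorem toContRep_spreadProjector_of_localComponent_eq_one
    (hψ : ∀ i j : Fin n, (i : ℕ) + 1 = j → ∀ x : v.adicCompletion K, Valued.v x ≤ exp (-M) →
      (adeleAddChar K).adicComponent v ((t i : v.adicCompletion K) * (t j : v.adicCompletion K)⁻¹ * x) = 1)
    {g : GL (Fin n) (AdeleRing (𝓞 K) K)} (hg : localComponent v g = 1) (x : W.toSubmodule) :
    W.toContRep g (spreadProjector v W t M x) = spreadProjector v W t M (W.toContRep g x) := by
  rw [spreadProjector_def, spreadProjector_def,
    ← ContinuousLinearMap.integral_comp_comm _ (integrable_spreadProjector_integrand hψ x)]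
  refine integral_congr_ae (Filter.Eventually.of_forall fun j => ?_)
  dsimp only
  rw [map_smul, ← ClosedSubrep.toContRep_mul_apply, ← ClosedSubrep.toContRep_mul_apply,
    GLn.ofLocal_mul_eq_mul_ofLocal_of_toLocal_eq_one _ hg]

omit [MeasurableSpace (GL (Fin n) (v.adicCompletion K))] [BorelSpace (GL (Fin n) (v.adicCompletion K))] in
/-- `(h, 1) ∈ GL_n(𝔸_K)` has trivial `v`-component. [folklore] -/
theorem localComponent_ofInfinite (h : GL (Fin n) (mixedSpace K)) :
    localComponent v (GLn.ofInfinite n K h) = 1 := by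
  refine Units.ext (Matrix.ext fun i j => ?_)
  change AdelicGroupData.adeleEval K v ((GLn.ofInfinite n K h : Matrix (Fin n) (Fin n) (AdeleRing (𝓞 K) K)) i j) =
    (1 : Matrix (Fin n) (Fin n) (v.adicCompletion K)) i j
  rw [GLn.coe_ofInfinite_apply, AdelicGroupData.adeleEval_apply, Matrix.one_apply, Matrix.one_apply]
  split_ifs <;> rfl

/-- **`E_v` commutes with `G_∞`.** [folklore] -/
theorem toContRep_ofInfinite_spreadProjector
    (hψ : ∀ i j : Fin n, (i : ℕ) + 1 = j → ∀ x : v.adicCompletion K, Valued.v x ≤ exp (-M) →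
      (adeleAddChar K).adicComponent v ((t i : v.adicCompletion K) * (t j : v.adicCompletion K)⁻¹ * x) = 1)
    (h : GL (Fin n) (mixedSpace K)) (x : W.toSubmodule) :
    W.toContRep (GLn.ofInfinite n K h) (spreadProjector v W t M x) =
      spreadProjector v W t M (W.toContRep (GLn.ofInfinite n K h) x) :=
  toContRep_spreadProjector_of_localComponent_eq_one hψ (localComponent_ofInfinite h) x

/-- **The level of `E_v x` at `v`**: if `Π(ι_v(k')) x = x` for all `k' ∈ K(r R²)` (`R` a bound for
the ratios `|t_i/t_j|`, `r R² ≤ 1`), then `Π(ι_v(k)) E_v x = E_v x` for all `k ∈ K(r)`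
(`h⁻¹ k h ∈ K(r R²)` for `h ∈ H_v`). [folklore] -/
theorem toContRep_ofLocal_spreadProjector_of_level
    (hψ : ∀ i j : Fin n, (i : ℕ) + 1 = j → ∀ x : v.adicCompletion K, Valued.v x ≤ exp (-M) →
      (adeleAddChar K).adicComponent v ((t i : v.adicCompletion K) * (t j : v.adicCompletion K)⁻¹ * x) = 1)
    {R r : ℤᵐ⁰} (hR : ∀ i j, Valued.v ((t i : v.adicCompletion K) * (t j : v.adicCompletion K)⁻¹) ≤ R)
    (hr : r * R * R ≤ 1) {x : W.toSubmodule}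
    (hfix : ∀ k' ∈ valuedCongruenceSubgroup (Fin n) (r * R * R), W.toContRep (GLn.ofLocal n K v k') x = x)
    {k : GL (Fin n) (v.adicCompletion K)} (hk : k ∈ valuedCongruenceSubgroup (Fin n) r) :
    W.toContRep (GLn.ofLocal n K v k) (spreadProjector v W t M x) = spreadProjector v W t M x := by
  rw [spreadProjector_def, ← ContinuousLinearMap.integral_comp_comm _ (integrable_spreadProjector_integrand hψ x)]
  refine integral_congr_ae (Filter.Eventually.of_forall fun j => ?_)
  dsimp only
  have hconj := conj_mem_valuedCongruenceSubgroup_of_mem_spreadLevelGroup hR hr j.2 hk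
  have e : GLn.ofLocal n K v k * GLn.ofLocal n K v (j : GL (Fin n) (v.adicCompletion K)) =
      GLn.ofLocal n K v (j : GL (Fin n) (v.adicCompletion K)) *
        GLn.ofLocal n K v ((j : GL (Fin n) (v.adicCompletion K))⁻¹ * k * (j : GL (Fin n) (v.adicCompletion K))) := by
    rw [← map_mul, ← map_mul]
    congr 1
    group
  rw [map_smul, ← ClosedSubrep.toContRep_mul_apply, e, ClosedSubrep.toContRep_mul_apply, hfix _ hconj]

/-- **`E_v x` is `Π(ι_v(K(r)))`-fixed at the other places' vectors**: if `Π(g) x = x` for a `g` of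
trivial `v`-component then `Π(g) E_v x = E_v x`. [folklore] -/
theorem toContRep_spreadProjector_eq_self_of_localComponent_eq_one
    (hψ : ∀ i j : Fin n, (i : ℕ) + 1 = j → ∀ x : v.adicCompletion K, Valued.v x ≤ exp (-M) →
      (adeleAddChar K).adicComponent v ((t i : v.adicCompletion K) * (t j : v.adicCompletion K)⁻¹ * x) = 1)
    {g : GL (Fin n) (AdeleRing (𝓞 K) K)} (hg : localComponent v g = 1) {x : W.toSubmodule}
    (hfix : W.toContRep g x = x) :
    W.toContRep g (spreadProjector v W t M x) = spreadProjector v W t M x := by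
  rw [toContRep_spreadProjector_of_localComponent_eq_one hψ hg, hfix]

omit [MeasurableSpace (GL (Fin n) (v.adicCompletion K))] [BorelSpace (GL (Fin n) (v.adicCompletion K))] in
/-- **Isotypy at `v` is preserved by operators commuting with `ι_v(H_v)`**: if `Π(ι_v(h)) y = χ_v(h) y`
for all `h ∈ H_v` and `g` has trivial `v`-component, then `Π(g) y` is again isotypic. [folklore] -/
theorem isotypic_toContRep_of_localComponent_eq_one {y : W.toSubmodule}
    (hy : ∀ h ∈ spreadLevelGroup t M, W.toContRep (GLn.ofLocal n K v h) y = spreadChar v h • y)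
    {g : GL (Fin n) (AdeleRing (𝓞 K) K)} (hg : localComponent v g = 1) :
    ∀ h ∈ spreadLevelGroup t M,
      W.toContRep (GLn.ofLocal n K v h) (W.toContRep g y) = spreadChar v h • W.toContRep g y := by
  intro h hh
  rw [← ClosedSubrep.toContRep_mul_apply, GLn.ofLocal_mul_eq_mul_ofLocal_of_toLocal_eq_one _ hg,
    ClosedSubrep.toContRep_mul_apply, hy h hh, map_smul]

end Projector

end Literature.NumberTheory.Automorphic
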